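import Mathlib.Analysis.MeanInequalities
import Mathlib.Analysis.SpecialFunctions.Pow.Complex
import Mathlib.Analysis.Complex.Basic
import HarnessLib

/-!
# Finite weighted `ℓ^p` spaces in reciprocal-exponent form: Hölder's inequality and the norming functional
# (the duality step of the Riesz–Thorin interpolation theorem)

Support file (definitions with bodies + fully proved theorems) for
`Literature/Analysis/FunctionSpaces/RieszThorin.lean`, which proves the **Riesz–Thorin interpolation theorem**
([Grafakos2014] L. Grafakos, *Classical Fourier Analysis*, 3rd ed., GTM 249, Springer 2014, Theorem 1.3.4 pp. 37–39)
for linear maps between FINITE weighted `ℓ^p` spaces over `ℂ` — i.e. for finite measure spaces `(X, μ)`, `(Y, ν)` all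
of whose points have positive mass, where every function is finitely simple.

## What is here

* `lnorm μ s f` — the norm `‖f‖_{L^p(μ)} = (Σ_i μ_i ‖f i‖^p)^{1/p}` written in the RECIPROCAL exponent `s = 1/p ∈ [0, 1]`
  (`s = 0` is the sup norm `‖f‖_{L^∞}`; with positive weights every point counts).  The reciprocal coordinates are the
  ones in which the theorem is a convexity statement — Riesz's "convexity theorem" — and the ones T. Bałaban draws
  ("the `(1/p, 1/q)`-plane", [Balaban1983RegularityDecay] p. 583); elementary API: `lnorm_nonneg`, `lnorm_smul`
  (absolute homogeneity), `eq_zero_of_lnorm_eq_zero`, `lnorm_inv` (the `p`-form dictionary).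
* `norm_sum_le_lnorm_mul_lnorm` — HÖLDER's inequality in the form used on p. 38 of [Grafakos2014]:
  `|Σ_k ν_k h_k g_k| ≤ ‖h‖_{L^q(ν)} ‖g‖_{L^{q'}(ν)}`, `1/q + 1/q' = 1`, for EVERY `q ∈ [1, ∞]` (`t = 1/q ∈ [0,1]`,
  the endpoint cases `q = 1, ∞` included); from Mathlib's `Real.inner_le_Lp_mul_Lq`.
* `exists_norming` — the finite-dimensional duality `(L^q)* = L^{q'}` in the attained form the proof uses
  ("`‖T(f)‖_{L^q} = sup_g |∫ T(f) g dν|`, the supremum taken over … `g` … with `L^{q'}` norm less than or equal to 1",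
  [Grafakos2014] p. 38): for every `h` there is `g` with `‖g‖_{L^{q'}} ≤ 1` and `Σ_k ν_k h_k g_k = ‖h‖_{L^q}` (an
  explicit extremal: `g = conj(sgn h)(|h|/‖h‖_q)^{q-1}`, resp. a normalised point mass at a maximiser when `q = ∞`).
* `lnorm_le_one_of_pow` — the modulus bookkeeping of the proof ("`‖f_{it}‖_{L^{p₀}} = ‖f‖_{L^p}^{p/p₀}` … even when
  `p₀ = ∞`", p. 38): if `|F| ≤ |f|^{r}` pointwise with `r = p/p₀` then `‖f‖_p ≤ 1 ⇒ ‖F‖_{p₀} ≤ 1`, including the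
  degenerate exponent configurations.

Everything is elementary and kernel-checked (standard axioms); nothing is asserted as a fact.  Written for the cell
`lit-balaban` (unit `lit-balaban-p04`, HOME `run/shared/lean/pub/lit-balaban/`), whose B4 block cites the Riesz–Thorin
theorem as an external input ([Balaban1983RegularityDecay] p. 583, Ref. [6] = Dunford–Schwartz, *Linear Operators* I,
VI.10); statement-level skeleton of published theorems with citation tags; proofs where landed; nothing here is a claim
about the Yang–Mills mass gap.
-/

noncomputable section

open Finset
open scoped BigOperators ComplexConjugate

namespace Literature.Analysis.FunctionSpaces.RieszThorin

variable {ι : Type*} [Fintype ι]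

/-! ## The weighted norms `‖·‖_{L^{1/s}(μ)}` -/

/-- `lnorm μ s f = ‖f‖_{L^{1/s}(μ)}`: for `s ≠ 0`, `(Σ_i μ_i ‖f i‖^{1/s})^{s}`; for `s = 0` the sup norm `‖f‖ = max_i ‖f i‖`
(the norm of `L^∞(μ)` when every weight is positive).  Reciprocal-exponent form of the `L^p` norms of
[Grafakos2014] §1.1 (`p = 1/s`). [cite: Grafakos2014, Thm 1.3.4 pp.37–39] -/
def lnorm (μ : ι → ℝ) (s : ℝ) (f : ι → ℂ) : ℝ :=
  if s = 0 then ‖f‖ else (∑ i, μ i * ‖f i‖ ^ s⁻¹) ^ s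

/-- `s = 0`: the sup norm. [cite: Grafakos2014, Thm 1.3.4 pp.37–39] -/
theorem lnorm_zero_exp (μ : ι → ℝ) (f : ι → ℂ) : lnorm μ 0 f = ‖f‖ := by simp [lnorm]

/-- `s ≠ 0`: the `L^{1/s}(μ)` sum. [cite: Grafakos2014, Thm 1.3.4 pp.37–39] -/
theorem lnorm_of_ne_zero (μ : ι → ℝ) {s : ℝ} (hs : s ≠ 0) (f : ι → ℂ) :
    lnorm μ s f = (∑ i, μ i * ‖f i‖ ^ s⁻¹) ^ s := by simp [lnorm, hs]

/-- dictionary with the usual exponent: `‖f‖_{L^p(μ)} = (Σ μ_i ‖f i‖^p)^{1/p}` is `lnorm μ p⁻¹ f` (`p ≠ 0`).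
[cite: Grafakos2014, Thm 1.3.4 pp.37–39] -/
theorem lnorm_inv (μ : ι → ℝ) {p : ℝ} (hp : p ≠ 0) (f : ι → ℂ) :
    lnorm μ p⁻¹ f = (∑ i, μ i * ‖f i‖ ^ p) ^ p⁻¹ := by
  rw [lnorm_of_ne_zero μ (inv_ne_zero hp), inv_inv]

/-- the sums inside the norms are nonnegative (private plumbing). [folklore] -/
private theorem sum_nonneg_aux {μ : ι → ℝ} (hμ : ∀ i, 0 ≤ μ i) (f : ι → ℂ) (e : ℝ) :
    0 ≤ ∑ i, μ i * ‖f i‖ ^ e :=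
  sum_nonneg fun i _ => mul_nonneg (hμ i) (Real.rpow_nonneg (norm_nonneg _) _)

/-- `L^p` norms are nonnegative. [cite: Grafakos2014, §1.1 pp.1–3] -/
theorem lnorm_nonneg {μ : ι → ℝ} (hμ : ∀ i, 0 ≤ μ i) (s : ℝ) (f : ι → ℂ) : 0 ≤ lnorm μ s f := by
  by_cases hs : s = 0
  · rw [hs, lnorm_zero_exp]; exact norm_nonneg _
  · rw [lnorm_of_ne_zero μ hs]; exact Real.rpow_nonneg (sum_nonneg_aux hμ f _) _

/-- `‖0‖_{L^p} = 0` (`s = 1/p ≥ 0`). [cite: Grafakos2014, §1.1 pp.1–3] -/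
theorem lnorm_zero_fun {μ : ι → ℝ} {s : ℝ} (hs : 0 ≤ s) : lnorm μ s (0 : ι → ℂ) = 0 := by
  by_cases h : s = 0
  · rw [h, lnorm_zero_exp, norm_zero]
  · rw [lnorm_of_ne_zero μ h]
    have hs' : 0 < s := lt_of_le_of_ne hs (Ne.symm h)
    simp [Real.zero_rpow (inv_ne_zero h), Real.zero_rpow h]

/-- absolute homogeneity `‖c·f‖ = |c|‖f‖` (the normalisation step of the proof of Thm 1.3.4). [cite: Grafakos2014, Thm 1.3.4 pp.37–39] -/
theorem lnorm_smul {μ : ι → ℝ} (hμ : ∀ i, 0 ≤ μ i) {s : ℝ} (hs : 0 ≤ s) (c : ℂ) (f : ι → ℂ) :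
    lnorm μ s (c • f) = ‖c‖ * lnorm μ s f := by
  by_cases h : s = 0
  · rw [h, lnorm_zero_exp, lnorm_zero_exp, norm_smul]
  · have hs' : 0 < s := lt_of_le_of_ne hs (Ne.symm h)
    rw [lnorm_of_ne_zero μ h, lnorm_of_ne_zero μ h]
    have : ∀ i, μ i * ‖(c • f) i‖ ^ s⁻¹ = ‖c‖ ^ s⁻¹ * (μ i * ‖f i‖ ^ s⁻¹) := by
      intro i
      rw [Pi.smul_apply, smul_eq_mul, norm_mul, Real.mul_rpow (norm_nonneg _) (norm_nonneg _)]
      ring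
    rw [Finset.sum_congr rfl fun i _ => this i, ← Finset.mul_sum,
      Real.mul_rpow (Real.rpow_nonneg (norm_nonneg _) _) (sum_nonneg_aux hμ f _),
      Real.rpow_inv_rpow (norm_nonneg _) h]

/-- with positive weights `‖f‖_{L^p(μ)} = 0` only for `f = 0`. [cite: Grafakos2014, §1.1 pp.1–3] -/
theorem eq_zero_of_lnorm_eq_zero {μ : ι → ℝ} (hμ : ∀ i, 0 < μ i) {s : ℝ} {f : ι → ℂ}
    (h : lnorm μ s f = 0) : f = 0 := by
  by_cases h0 : s = 0
  · rw [h0, lnorm_zero_exp] at h; exact norm_eq_zero.mp h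
  · rw [lnorm_of_ne_zero μ h0] at h
    have hsum := ((Real.rpow_eq_zero (sum_nonneg_aux (fun i => (hμ i).le) f _) h0).mp h)
    rw [Finset.sum_eq_zero_iff_of_nonneg fun i _ =>
      mul_nonneg (hμ i).le (Real.rpow_nonneg (norm_nonneg _) _)] at hsum
    funext i
    have hi := hsum i (mem_univ i)
    rcases mul_eq_zero.mp hi with hμ0 | hf
    · exact absurd hμ0 (hμ i).ne'
    · rw [Real.rpow_eq_zero (norm_nonneg _) (inv_ne_zero h0)] at hf
      exact norm_eq_zero.mp hf

/-- the sup norm of a function on a finite type is attained (the maximiser used for `q = ∞`; private plumbing). [folklore] -/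
private theorem exists_norm_eq_pi_norm [Nonempty ι] (f : ι → ℂ) : ∃ i, ‖f i‖ = ‖f‖ := by
  obtain ⟨i, _, hi⟩ := Finset.exists_max_image univ (fun i => ‖f i‖) univ_nonempty
  refine ⟨i, le_antisymm (norm_le_pi_norm f i) ?_⟩
  exact (pi_norm_le_iff_of_nonneg (norm_nonneg _)).mpr fun j => hi j (mem_univ j)

/-! ## Hölder's inequality in reciprocal-exponent form -/

/-- **Hölder's inequality** on a finite weighted space, all exponents: `|Σ_k ν_k h_k g_k| ≤ ‖h‖_{L^{1/t}(ν)} ‖g‖_{L^{1/(1-t)}(ν)}`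
for `t ∈ [0, 1]` (`t = 0`: `L^∞ × L¹`; `t = 1`: `L¹ × L^∞`; `0 < t < 1`: Mathlib `Real.inner_le_Lp_mul_Lq` with the weights split as
`ν^t · ν^{1-t}`) — "Hölder's inequality says that for all p ∈ [1,∞] …" [Grafakos2014] §1.1, the step "Hölder's
inequality and the hypothesis give (1.3.17)" of the proof of Thm 1.3.4 p. 38. [cite: Grafakos2014, §1.1 pp.2–3] -/
theorem norm_sum_le_lnorm_mul_lnorm {κ : Type*} [Fintype κ] {ν : κ → ℝ} (hν : ∀ k, 0 < ν k)
    {t : ℝ} (ht0 : 0 ≤ t) (ht1 : t ≤ 1) (h g : κ → ℂ) :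
    ‖∑ k, (ν k : ℂ) * (h k * g k)‖ ≤ lnorm ν t h * lnorm ν (1 - t) g := by
  have step1 : ‖∑ k, (ν k : ℂ) * (h k * g k)‖ ≤ ∑ k, ν k * (‖h k‖ * ‖g k‖) := by
    refine (norm_sum_le _ _).trans (le_of_eq (Finset.sum_congr rfl fun k _ => ?_))
    rw [norm_mul, norm_mul, Complex.norm_real, Real.norm_of_nonneg (hν k).le]
  refine step1.trans ?_
  rcases eq_or_lt_of_le ht0 with rfl | ht0'
  · -- t = 0 : sup × L¹
    rw [lnorm_zero_exp, sub_zero, lnorm_of_ne_zero ν one_ne_zero, inv_one, Real.rpow_one]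
    simp_rw [Real.rpow_one]
    rw [Finset.mul_sum]
    exact Finset.sum_le_sum fun k _ => by
      have := norm_le_pi_norm h k
      nlinarith [(hν k).le, norm_nonneg (g k), mul_nonneg (hν k).le (norm_nonneg (g k))]
  rcases eq_or_lt_of_le ht1 with rfl | ht1'
  · -- t = 1 : L¹ × sup
    rw [sub_self, lnorm_zero_exp, lnorm_of_ne_zero ν one_ne_zero, inv_one, Real.rpow_one]
    simp_rw [Real.rpow_one]
    rw [Finset.sum_mul]
    exact Finset.sum_le_sum fun k _ => by
      have := norm_le_pi_norm g k
      nlinarith [(hν k).le, norm_nonneg (h k), mul_nonneg (hν k).le (norm_nonneg (h k))]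
  · -- 0 < t < 1 : genuine Hölder with p = 1/t, q = 1/(1-t)
    have h1t : 0 < 1 - t := sub_pos.mpr ht1'
    have hpq : (t⁻¹).HolderConjugate (1 - t)⁻¹ := by
      rw [Real.holderConjugate_iff]
      refine ⟨(one_lt_inv₀ ht0').mpr ht1', ?_⟩
      rw [inv_inv, inv_inv]; ring
    have H := Real.inner_le_Lp_mul_Lq univ (fun k => ν k ^ t * ‖h k‖) (fun k => ν k ^ (1 - t) * ‖g k‖) hpq
    have lhs : ∑ k, ν k ^ t * ‖h k‖ * (ν k ^ (1 - t) * ‖g k‖) = ∑ k, ν k * (‖h k‖ * ‖g k‖) := by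
      refine Finset.sum_congr rfl fun k _ => ?_
      have : ν k ^ t * ν k ^ (1 - t) = ν k := by
        rw [← Real.rpow_add (hν k)]; norm_num
      calc ν k ^ t * ‖h k‖ * (ν k ^ (1 - t) * ‖g k‖) = (ν k ^ t * ν k ^ (1 - t)) * (‖h k‖ * ‖g k‖) := by ring
        _ = _ := by rw [this]
    rw [lhs] at H
    have eA : ∀ k, |ν k ^ t * ‖h k‖| ^ t⁻¹ = ν k * ‖h k‖ ^ t⁻¹ := by
      intro k
      rw [abs_of_nonneg (mul_nonneg (Real.rpow_nonneg (hν k).le _) (norm_nonneg _)),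
        Real.mul_rpow (Real.rpow_nonneg (hν k).le _) (norm_nonneg _), ← Real.rpow_mul (hν k).le,
        mul_inv_cancel₀ ht0'.ne', Real.rpow_one]
    have eB : ∀ k, |ν k ^ (1 - t) * ‖g k‖| ^ (1 - t)⁻¹ = ν k * ‖g k‖ ^ (1 - t)⁻¹ := by
      intro k
      rw [abs_of_nonneg (mul_nonneg (Real.rpow_nonneg (hν k).le _) (norm_nonneg _)),
        Real.mul_rpow (Real.rpow_nonneg (hν k).le _) (norm_nonneg _), ← Real.rpow_mul (hν k).le,
        mul_inv_cancel₀ h1t.ne', Real.rpow_one]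
    simp_rw [eA, eB, one_div, inv_inv] at H
    rw [lnorm_of_ne_zero ν ht0'.ne', lnorm_of_ne_zero ν h1t.ne']
    exact H

/-! ## The unit part `sgn w = w/|w|` and the norming functional -/

/-- `sgn w = w/|w|` (`0` at `w = 0`): the phase `e^{iα_k}` of the polar form in [Grafakos2014] (1.3.16). [cite: Grafakos2014, Thm 1.3.4 pp.37–39] -/
def sgn (w : ℂ) : ℂ := if w = 0 then 0 else w / (‖w‖ : ℂ)

/-- `sgn 0 = 0` (private plumbing). [folklore] -/
private theorem sgn_zero : sgn 0 = 0 := by simp [sgn]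

/-- `|sgn w| ≤ 1` (private plumbing). [folklore] -/
private theorem norm_sgn_le_one (w : ℂ) : ‖sgn w‖ ≤ 1 := by
  by_cases h : w = 0
  · simp [sgn, h]
  · rw [sgn, if_neg h, norm_div, Complex.norm_real, Real.norm_of_nonneg (norm_nonneg _),
      div_self (norm_ne_zero_iff.mpr h)]

/-- `|sgn w| = 1` for `w ≠ 0`: the unit modulus of the phase `e^{iα_k}` in (1.3.16). [cite: Grafakos2014, Thm 1.3.4 pp.37–39] -/
theorem norm_sgn_of_ne_zero {w : ℂ} (h : w ≠ 0) : ‖sgn w‖ = 1 := by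
  rw [sgn, if_neg h, norm_div, Complex.norm_real, Real.norm_of_nonneg (norm_nonneg _),
    div_self (norm_ne_zero_iff.mpr h)]

/-- polar form `w = |w|·sgn w` (the `a_k e^{iα_k}` of [Grafakos2014] (1.3.16)). [cite: Grafakos2014, Thm 1.3.4 pp.37–39] -/
theorem norm_mul_sgn (w : ℂ) : (‖w‖ : ℂ) * sgn w = w := by
  by_cases h : w = 0
  · simp [sgn, h]
  · rw [sgn, if_neg h, mul_div_cancel₀ _ (by exact_mod_cast norm_ne_zero_iff.mpr h)]

/-- `w · conj(sgn w) = |w|` (private plumbing). [folklore] -/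
private theorem mul_conj_sgn (w : ℂ) : w * conj (sgn w) = (‖w‖ : ℂ) := by
  by_cases h : w = 0
  · simp [sgn, h]
  · rw [sgn, if_neg h, map_div₀, Complex.conj_ofReal, mul_div_assoc', Complex.mul_conj,
      Complex.normSq_eq_norm_sq]
    have : (‖w‖ : ℂ) ≠ 0 := by exact_mod_cast norm_ne_zero_iff.mpr h
    field_simp
    push_cast
    ring

/-- **Norming functional** (finite-dimensional duality `(L^q)* = L^{q'}`, attained): for `t = 1/q ∈ [0, 1]` and every `h`
there is `g` with `‖g‖_{L^{q'}(ν)} ≤ 1` (`1/q' = 1 - t`) and `Σ_k ν_k h_k g_k = ‖h‖_{L^q(ν)}` — the extremal in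
"`‖T(f)‖_{L^q} = sup_g |∫_Y T(f) g dν|` … over all finitely simple `g` with `L^{q'}` norm ≤ 1" ([Grafakos2014] p. 38):
`g = conj(sgn h)·(|h|/‖h‖_q)^{q-1}` for `q < ∞`, a normalised point mass at a maximiser of `|h|` for `q = ∞`.
[cite: Grafakos2014, Thm 1.3.4 pp.37–39] -/
theorem exists_norming {κ : Type*} [Fintype κ] [DecidableEq κ] {ν : κ → ℝ} (hν : ∀ k, 0 < ν k)
    {t : ℝ} (ht0 : 0 ≤ t) (ht1 : t ≤ 1) (h : κ → ℂ) :
    ∃ g : κ → ℂ, lnorm ν (1 - t) g ≤ 1 ∧ ∑ k, (ν k : ℂ) * (h k * g k) = (lnorm ν t h : ℂ) := by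
  by_cases hh : h = 0
  · refine ⟨0, ?_, ?_⟩
    · rw [lnorm_zero_fun (sub_nonneg.mpr ht1)]; exact zero_le_one
    · subst hh; simp [lnorm_zero_fun ht0]
  have hne : Nonempty κ := by
    by_contra hκ
    rw [not_nonempty_iff] at hκ
    exact hh (funext fun k => (IsEmpty.false k).elim)
  rcases eq_or_lt_of_le ht0 with rfl | ht0'
  · -- t = 0: evaluation at a maximiser, g = δ_{k₀} conj(sgn h k₀)/ν k₀
    obtain ⟨k₀, hk₀⟩ := exists_norm_eq_pi_norm h
    have hk₀ne : h k₀ ≠ 0 := by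
      intro h0; apply hh
      have : ‖h‖ = 0 := by rw [← hk₀, h0, norm_zero]
      exact norm_eq_zero.mp this
    refine ⟨fun k => if k = k₀ then ((ν k₀ : ℂ))⁻¹ * conj (sgn (h k₀)) else 0, ?_, ?_⟩
    · rw [sub_zero, lnorm_of_ne_zero ν one_ne_zero, inv_one, Real.rpow_one]
      simp_rw [Real.rpow_one]
      rw [Finset.sum_eq_single k₀ (fun k _ hk => by simp [hk]) (fun hk => absurd (mem_univ k₀) hk)]
      simp only [if_true, norm_mul, norm_inv, Complex.norm_real, Real.norm_of_nonneg (hν k₀).le,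
        Complex.norm_conj, norm_sgn_of_ne_zero hk₀ne, mul_one]
      rw [mul_inv_cancel₀ (hν k₀).ne']
    · rw [lnorm_zero_exp, Finset.sum_eq_single k₀ (fun k _ hk => by simp [hk]) (fun hk => absurd (mem_univ k₀) hk)]
      simp only [if_true]
      have hν0 : (ν k₀ : ℂ) ≠ 0 := by exact_mod_cast (hν k₀).ne'
      calc (ν k₀ : ℂ) * (h k₀ * (((ν k₀ : ℂ))⁻¹ * conj (sgn (h k₀))))
          = ((ν k₀ : ℂ) * ((ν k₀ : ℂ))⁻¹) * (h k₀ * conj (sgn (h k₀))) := by ring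
        _ = (‖h‖ : ℂ) := by rw [mul_inv_cancel₀ hν0, one_mul, mul_conj_sgn, hk₀]
  · -- 0 < t ≤ 1: g_k = conj(sgn h_k) (‖h_k‖/N)^{(1-t)/t}
    set N := lnorm ν t h with hN
    have hNpos : 0 < N := by
      rcases (lnorm_nonneg (fun k => (hν k).le) t h).eq_or_lt with h0 | h0
      · exact absurd (eq_zero_of_lnorm_eq_zero hν h0.symm) hh
      · exact h0
    have hNt : ∑ k, ν k * ‖h k‖ ^ t⁻¹ = N ^ t⁻¹ := by
      rw [hN, lnorm_of_ne_zero ν ht0'.ne', Real.rpow_rpow_inv (sum_nonneg_aux (fun k => (hν k).le) h _) ht0'.ne']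
    set e : ℝ := (1 - t) / t with he
    refine ⟨fun k => conj (sgn (h k)) * (((‖h k‖ / N) ^ e : ℝ) : ℂ), ?_, ?_⟩
    · -- the dual norm is ≤ 1 (= 1)
      rcases eq_or_lt_of_le ht1 with rfl | ht1'
      · rw [sub_self, lnorm_zero_exp]
        refine (pi_norm_le_iff_of_nonneg zero_le_one).mpr fun k => ?_
        have : e = 0 := by rw [he]; simp
        rw [this, Real.rpow_zero, Complex.ofReal_one, mul_one, Complex.norm_conj]
        exact norm_sgn_le_one _
      · have h1t : 0 < 1 - t := sub_pos.mpr ht1'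
        have hepos : 0 < e := div_pos h1t ht0'
        rw [lnorm_of_ne_zero ν h1t.ne']
        have hterm : ∀ k, ν k * ‖conj (sgn (h k)) * (((‖h k‖ / N) ^ e : ℝ) : ℂ)‖ ^ (1 - t)⁻¹
            = (N ^ t⁻¹)⁻¹ * (ν k * ‖h k‖ ^ t⁻¹) := by
          intro k
          have hq : ‖conj (sgn (h k)) * (((‖h k‖ / N) ^ e : ℝ) : ℂ)‖ = (‖h k‖ / N) ^ e := by
            by_cases hk : h k = 0
            · rw [hk, norm_zero, zero_div, Real.zero_rpow hepos.ne', sgn_zero, map_zero, zero_mul, norm_zero]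
            · rw [norm_mul, Complex.norm_conj, norm_sgn_of_ne_zero hk, one_mul, Complex.norm_real,
                Real.norm_of_nonneg (Real.rpow_nonneg (div_nonneg (norm_nonneg _) hNpos.le) _)]
          rw [hq, ← Real.rpow_mul (div_nonneg (norm_nonneg _) hNpos.le)]
          have : e * (1 - t)⁻¹ = t⁻¹ := by rw [he]; field_simp
          rw [this, Real.div_rpow (norm_nonneg _) hNpos.le]
          ring
        rw [Finset.sum_congr rfl fun k _ => hterm k, ← Finset.mul_sum, hNt,
          inv_mul_cancel₀ (Real.rpow_pos_of_pos hNpos _).ne', Real.one_rpow]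
    · -- the pairing equals N
      have hterm : ∀ k, (ν k : ℂ) * (h k * (conj (sgn (h k)) * (((‖h k‖ / N) ^ e : ℝ) : ℂ)))
          = ((ν k * (‖h k‖ * (‖h k‖ / N) ^ e) : ℝ) : ℂ) := by
        intro k
        push_cast
        rw [← mul_conj_sgn (h k)]
        ring
      rw [Finset.sum_congr rfl fun k _ => hterm k]
      rw [← Complex.ofReal_sum]  -- may need the right lemma name
      congr 1
      have hk : ∀ k, ν k * (‖h k‖ * (‖h k‖ / N) ^ e) = (N ^ e)⁻¹ * (ν k * ‖h k‖ ^ t⁻¹) := by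
        intro k
        rw [Real.div_rpow (norm_nonneg _) hNpos.le]
        have : ‖h k‖ * ‖h k‖ ^ e = ‖h k‖ ^ t⁻¹ := by
          have : t⁻¹ = 1 + e := by rw [he]; field_simp; ring
          rw [this, Real.rpow_add' (norm_nonneg _) (by rw [← this]; exact inv_ne_zero ht0'.ne'), Real.rpow_one]
        rw [← this]
        field_simp
      rw [Finset.sum_congr rfl fun k _ => hk k, ← Finset.mul_sum, hNt, ← Real.rpow_neg hNpos.le,
        ← Real.rpow_add hNpos]
      have : -e + t⁻¹ = 1 := by rw [he]; field_simp; ring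
      rw [this, Real.rpow_one]

/-! ## The modulus bookkeeping `‖f_{it}‖_{p₀} ≤ 1` of the proof -/

/-- the three admissible exponent configurations of the proof (Grafakos p.38: "even when p₀ = ∞", "even when q₀ = 1"):
`‖F i‖ ≤ ‖f i‖^r` with `r = s'/σ` (both positive), or `r = 0` with target the sup norm, or the degenerate `σ = s' = 0`,
`r = 1`; in each case `‖f‖_{1/σ} ≤ 1 ⇒ ‖F‖_{1/s'} ≤ 1`. [cite: Grafakos2014, Thm 1.3.4 pp.37–39] -/
theorem lnorm_le_one_of_pow {μ : ι → ℝ} (hμ : ∀ i, 0 < μ i) {σ s' r : ℝ} {f F : ι → ℂ}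
    (hF : ∀ i, ‖F i‖ ≤ ‖f i‖ ^ r) (hf : lnorm μ σ f ≤ 1)
    (hcase : (0 < s' ∧ 0 < σ ∧ r = s' / σ) ∨ (s' = 0 ∧ r = 0) ∨ (s' = 0 ∧ σ = 0 ∧ r = 1)) :
    lnorm μ s' F ≤ 1 := by
  rcases hcase with ⟨hs', hσ, hr⟩ | ⟨hs', hr⟩ | ⟨hs', hσ, hr⟩
  · rw [lnorm_of_ne_zero μ hs'.ne']
    rw [lnorm_of_ne_zero μ hσ.ne'] at hf
    have hsum : ∑ i, μ i * ‖f i‖ ^ σ⁻¹ ≤ 1 := by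
      have h1 := Real.rpow_le_rpow (Real.rpow_nonneg (sum_nonneg_aux (fun i => (hμ i).le) f _) _) hf
        (inv_nonneg.mpr hσ.le) (z := σ⁻¹)
      rwa [Real.rpow_rpow_inv (sum_nonneg_aux (fun i => (hμ i).le) f _) hσ.ne', Real.one_rpow] at h1
    have hle : ∑ i, μ i * ‖F i‖ ^ s'⁻¹ ≤ ∑ i, μ i * ‖f i‖ ^ σ⁻¹ := by
      refine Finset.sum_le_sum fun i _ => mul_le_mul_of_nonneg_left ?_ (hμ i).le
      calc ‖F i‖ ^ s'⁻¹ ≤ (‖f i‖ ^ r) ^ s'⁻¹ :=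
            Real.rpow_le_rpow (norm_nonneg _) (hF i) (inv_nonneg.mpr hs'.le)
        _ = ‖f i‖ ^ σ⁻¹ := by
            rw [← Real.rpow_mul (norm_nonneg _), hr]; congr 1; field_simp
    calc (∑ i, μ i * ‖F i‖ ^ s'⁻¹) ^ s' ≤ (1 : ℝ) ^ s' :=
          Real.rpow_le_rpow (sum_nonneg_aux (fun i => (hμ i).le) F _) (hle.trans hsum) hs'.le
      _ = 1 := Real.one_rpow _
  · rw [hs', lnorm_zero_exp]
    refine (pi_norm_le_iff_of_nonneg zero_le_one).mpr fun i => (hF i).trans ?_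
    rw [hr, Real.rpow_zero]
  · rw [hs', lnorm_zero_exp]
    rw [hσ, lnorm_zero_exp] at hf
    refine (pi_norm_le_iff_of_nonneg zero_le_one).mpr fun i => (hF i).trans ?_
    rw [hr, Real.rpow_one]
    exact (norm_le_pi_norm f i).trans hf

end Literature.Analysis.FunctionSpaces.RieszThorin
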